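import Summits.QuantumFields.GaugeBoot.TiltedLatticeGauge
import HarnessLib

/-!
# Reversing one axis of a periodic lattice: the same Wilson theory in a second presentation (gauge-boot, L3 supplement)

HONEST FRAMING (cell `pub-gaugeboot`, page 1 of every file): the venture produces certified bounds
on lattice expectations at stated coupling, gauge group, dimension and torus size; NOT a mass gap,
NOT a continuum limit, NOT a string tension; NOT Yang–Mills-summit-bearing (barriers
`FixedCouplingUltralocality`, `PerturbativeInvisibility`).

A periodic lattice `(A, e)` (`TiltedLatticeGauge.lean`) with ONE marked translation reversed,
`e' = revAxis e j` (`e'_j = -e_j`, `e'_l = e_l` otherwise), describes the same graph: the `e'`-link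
`(x, j)` runs from `x` to `x - e_j`, i.e. it is the `e`-link `(x - e_j, j)` traversed backwards.
Accordingly the map of configurations

  `revConfig e j U (x, j) = U(x - e_j, j)⁻¹`,  `revConfig e j U (x, l) = U(x, l)` (`l ≠ j`)

identifies the two Wilson theories: plaquette holonomies containing the axis `j` are conjugated and
inverted and read at the base point shifted by `-e_j` (`holonomy_revConfig_left/right`), so the
Wilson action is preserved (`wilsonAction_revConfig`: `S_{e'}(revConfig U) = S_e(U)`), the product
Haar measure is preserved (`measurePreserving_revConfig`: relabelling of the `j`-links composed with
inversion), hence **`integral_comp_revConfig_gibbs`**: `∫ F(revConfig e j U) dμ_{e,β}(U) =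
∫ F dμ_{e',β}` for every measurable `F` and every real `β`. Purpose: a reflection that exchanges
`e_i` with `-e_j` (the ANTI-DIAGONAL mirror `x_i ↦ -x_j` of the 45°-tilted box, which is a symmetry
of EVERY tilted lattice `Γ(M_u, M_v)`, square or not) becomes a tilted diagonal frame of the
presentation `(A, e')` (`TiltedBoxAntiDiagonalRPGeneral.lean`), so the tree's abstract diagonal RP
theorem applies verbatim. Everything is `[folklore]`.

References: K. Osterwalder, E. Seiler, Ann. Phys. 110 (1978) 440, §2 (orientation conventions);
J. Fröhlich, R. Israel, E. H. Lieb, B. Simon, J. Stat. Phys. 22 (1980) 297, §3.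
-/

noncomputable section

open MeasureTheory
open Literature.MathematicalPhysics.QuantumFieldTheory (haarProbability)
open Literature.RepresentationTheory.CompactGroups

namespace Summit.QuantumFields.GaugeBoot

namespace TiltedRP

variable {A : Type*} [AddCommGroup A] {d N : ℕ} {G : Type*} [Group G]

/-! ## The reversed presentation and the identification of configurations -/

/-- The marked translations with the axis `j` reversed: `e'_j = -e_j`, `e'_l = e_l` (`l ≠ j`).
[folklore] -/
def revAxis (e : Fin d → A) (j : Fin d) : Fin d → A := Function.update e j (-e j)

/-- `revAxis` on the reversed axis. [folklore] -/
@[simp] theorem revAxis_self (e : Fin d → A) (j : Fin d) : revAxis e j j = -e j := by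
  simp [revAxis]

/-- `revAxis` on the other axes. [folklore] -/
theorem revAxis_of_ne (e : Fin d → A) {j l : Fin d} (hl : l ≠ j) : revAxis e j l = e l := by
  simp [revAxis, hl]

/-- Reversing twice gives back the original translations. [folklore] -/
@[simp] theorem revAxis_revAxis (e : Fin d → A) (j : Fin d) : revAxis (revAxis e j) j = e := by
  funext l
  by_cases hl : l = j
  · subst hl; simp [revAxis]
  · simp [revAxis, hl]

/-- The relabelling of the `j`-links: `(x, j) ↦ (x + e_j, j)` (inverse `(x, j) ↦ (x - e_j, j)`), other
links fixed. [folklore] -/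
def jShift (e : Fin d → A) (j : Fin d) : Equiv.Perm (Link A d) where
  toFun l := if l.2 = j then (l.1 + e j, l.2) else l
  invFun l := if l.2 = j then (l.1 - e j, l.2) else l
  left_inv l := by
    obtain ⟨x, m⟩ := l
    by_cases hm : m = j
    · subst hm; simp
    · simp [hm]
  right_inv l := by
    obtain ⟨x, m⟩ := l
    by_cases hm : m = j
    · subst hm; simp
    · simp [hm]

/-- **The identification of configurations**: `revConfig e j U (x, j) = U(x - e_j, j)⁻¹` (the
`e'`-link `(x, j)` is the `e`-link `(x - e_j, j)` traversed backwards), other links unchanged.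
[folklore] -/
def revConfig (e : Fin d → A) (j : Fin d) (U : Config A d G) : Config A d G :=
  fun l => (if l.2 = j then (fun g : G => g⁻¹) else id) (U ((jShift e j).symm l))

/-- `revConfig` on a `j`-link. [folklore] -/
@[simp] theorem revConfig_self (e : Fin d → A) (j : Fin d) (U : Config A d G) (x : A) :
    revConfig e j U (x, j) = (U (x - e j, j))⁻¹ := by
  simp [revConfig, jShift]

/-- `revConfig` on an `l`-link, `l ≠ j`. [folklore] -/
theorem revConfig_other (e : Fin d → A) (j : Fin d) (U : Config A d G) (x : A) {l : Fin d}
    (hl : l ≠ j) : revConfig e j U (x, l) = U (x, l) := by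
  simp [revConfig, jShift, hl]

/-- Reversing back: `revConfig e' j (revConfig e j U) = U`. [folklore] -/
theorem revConfig_revConfig (e : Fin d → A) (j : Fin d) (U : Config A d G) :
    revConfig (revAxis e j) j (revConfig e j U) = U := by
  funext l
  obtain ⟨x, m⟩ := l
  by_cases hm : m = j
  · subst hm
    rw [revConfig_self, revAxis_self, sub_neg_eq_add, revConfig_self, inv_inv, add_sub_cancel_right]
  · rw [revConfig_other _ _ _ _ hm, revConfig_other _ _ _ _ hm]

/-- … and `revConfig e j (revConfig e' j V) = V`. [folklore] -/
theorem revConfig_revConfig' (e : Fin d → A) (j : Fin d) (V : Config A d G) :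
    revConfig e j (revConfig (revAxis e j) j V) = V := by
  have h := revConfig_revConfig (revAxis e j) j V
  rwa [revAxis_revAxis] at h

/-! ## Holonomies and the Wilson action -/

/-- Plaquettes without a `j`-side: unchanged. [folklore] -/
theorem holonomy_revConfig_other (e : Fin d → A) (U : Config A d G) (x : A) {j k l : Fin d}
    (hk : k ≠ j) (hl : l ≠ j) :
    holonomy (revAxis e j) (revConfig e j U) x k l = holonomy e U x k l := by
  simp only [holonomy, revConfig_other _ _ _ _ hk, revConfig_other _ _ _ _ hl, revAxis_of_ne _ hk,
    revAxis_of_ne _ hl]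

/-- Plaquettes `(j, l)`: conjugated, inverted, read at `x - e_j`. [folklore] -/
theorem holonomy_revConfig_left (e : Fin d → A) (U : Config A d G) (x : A) {j l : Fin d} (hl : l ≠ j) :
    holonomy (revAxis e j) (revConfig e j U) x j l =
      ((U (x - e j, j))⁻¹ * holonomy e U (x - e j) j l * U (x - e j, j))⁻¹ := by
  simp only [holonomy, revConfig_self, revConfig_other _ _ _ _ hl, revAxis_self, revAxis_of_ne _ hl,
    ← sub_eq_add_neg, add_sub_right_comm x (e l) (e j), sub_add_cancel, mul_inv_rev, inv_inv]
  group

/-- Plaquettes `(k, j)`: conjugated, inverted, read at `x - e_j`. [folklore] -/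
theorem holonomy_revConfig_right (e : Fin d → A) (U : Config A d G) (x : A) {j k : Fin d} (hk : k ≠ j) :
    holonomy (revAxis e j) (revConfig e j U) x k j =
      ((U (x - e j, j))⁻¹ * holonomy e U (x - e j) k j * U (x - e j, j))⁻¹ := by
  simp only [holonomy, revConfig_self, revConfig_other _ _ _ _ hk, revAxis_self, revAxis_of_ne _ hk,
    ← sub_eq_add_neg, add_sub_right_comm x (e k) (e j), sub_add_cancel, mul_inv_rev, inv_inv]
  group

/-- The base-point shift of the plaquettes with a `j`-side. [folklore] -/
def plaqJShift (e : Fin d → A) (j : Fin d) : Equiv.Perm (Plaq A d) where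
  toFun p := if p.2.1.1 = j ∨ p.2.1.2 = j then (p.1 - e j, p.2) else p
  invFun p := if p.2.1.1 = j ∨ p.2.1.2 = j then (p.1 + e j, p.2) else p
  left_inv p := by
    obtain ⟨x, q⟩ := p
    by_cases h : q.1.1 = j ∨ q.1.2 = j
    · simp [h]
    · simp [h]
  right_inv p := by
    obtain ⟨x, q⟩ := p
    by_cases h : q.1.1 = j ∨ q.1.2 = j
    · simp [h]
    · simp [h]

variable [TopologicalSpace G] [IsTopologicalGroup G] [CompactSpace G] (ρ : G →* Matrix (Fin N) (Fin N) ℂ)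

/-- **Plaquette observables in the reversed presentation**: `Re tr ρ` of the `e'`-plaquette `p` of
`revConfig U` is `Re tr ρ` of the `e`-plaquette `plaqJShift p` of `U`. [folklore] -/
theorem plaqObs_revConfig (hρ : Continuous ρ) (e : Fin d → A) (j : Fin d) (p : Plaq A d)
    (U : Config A d G) :
    plaqObs ρ (revAxis e j) p (revConfig e j U) = plaqObs ρ e (plaqJShift e j p) U := by
  obtain ⟨x, ⟨⟨k, l⟩, hkl⟩⟩ := p
  simp only [plaqObs, plaqJShift, Equiv.coe_fn_mk]
  by_cases hk : k = j
  · subst hk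
    have hl : l ≠ k := fun h => (lt_irrefl k) (h ▸ hkl)
    rw [if_pos (Or.inl rfl), holonomy_revConfig_left e U x hl, CompactGroup.re_trace_map_inv ρ hρ]
    have hc := CompactGroup.trace_conj_eq ρ (holonomy e U (x - e k) k l) (U (x - e k, k))⁻¹
    rw [inv_inv] at hc
    rw [hc]
  · by_cases hl : l = j
    · subst hl
      rw [if_pos (Or.inr rfl), holonomy_revConfig_right e U x hk, CompactGroup.re_trace_map_inv ρ hρ]
      have hc := CompactGroup.trace_conj_eq ρ (holonomy e U (x - e l) k l) (U (x - e l, l))⁻¹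
      rw [inv_inv] at hc
      rw [hc]
    · rw [if_neg (not_or.2 ⟨hk, hl⟩), holonomy_revConfig_other e U x hk hl]

/-- **The Wilson action is the same in both presentations**: `S_{e'}(revConfig U) = S_e(U)`.
[folklore] -/
theorem wilsonAction_revConfig [Fintype A] (hρ : Continuous ρ) (e : Fin d → A) (j : Fin d)
    (U : Config A d G) : wilsonAction ρ (revAxis e j) (revConfig e j U) = wilsonAction ρ e U := by
  rw [wilsonAction_eq, wilsonAction_eq]
  congr 1
  exact Fintype.sum_equiv (plaqJShift e j) _ _ fun p => plaqObs_revConfig ρ hρ e j p U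

/-! ## The product Haar measure and the Wilson measure -/

section Measure

variable [MeasurableSpace G] [BorelSpace G] [Fintype A]

omit [TopologicalSpace G] [IsTopologicalGroup G] [CompactSpace G] [MeasurableSpace G] [BorelSpace G]
  [Fintype A] in
/-- `revConfig` = (invert the `j`-link variables) ∘ (relabel the `j`-links). [folklore] -/
theorem revConfig_eq_comp (e : Fin d → A) (j : Fin d) :
    (revConfig (G := G) e j : Config A d G → Config A d G) =
      (fun V l => (if l.2 = j then (fun g : G => g⁻¹) else id) (V l)) ∘
        fun U l => U ((jShift e j).symm l) := by
  funext U l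
  rfl

/-- **`revConfig` preserves the product Haar measure.** [folklore] -/
theorem measurePreserving_revConfig (e : Fin d → A) (j : Fin d) :
    MeasurePreserving (revConfig (G := G) e j) (productHaar A d G) (productHaar A d G) := by
  haveI : IsProbabilityMeasure (haarProbability G) :=
    CompactGroup.isProbabilityMeasure_haarMeasure_top
  haveI : (haarProbability G).IsInvInvariant := by
    unfold haarProbability; exact CompactGroup.isInvInvariant_of_isHaarMeasure _
  have h1 : MeasurePreserving (fun U l => U ((jShift e j).symm l) : Config A d G → Config A d G)
      (productHaar A d G) (productHaar A d G) := by
    have h := measurePreserving_arrowCongr' (fun _ : Link A d => haarProbability G)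
      (fun _ : Link A d => haarProbability G) (jShift e j) (MeasurableEquiv.refl G)
      fun _ => MeasurePreserving.id _
    have heq : (fun U l => U ((jShift e j).symm l) : Config A d G → Config A d G) =
        ⇑(MeasurableEquiv.arrowCongr' (jShift e j) (MeasurableEquiv.refl G)) := by
      funext U l; rfl
    rw [heq]; exact h
  have h2 : MeasurePreserving
      (fun V l => (if l.2 = j then (fun g : G => g⁻¹) else id) (V l) : Config A d G → Config A d G)
      (productHaar A d G) (productHaar A d G) := by
    unfold productHaar
    refine measurePreserving_pi _ _ fun l => ?_
    split_ifs
    · exact Measure.measurePreserving_inv _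
    · exact MeasurePreserving.id _
  rw [revConfig_eq_comp]
  exact h2.comp h1

omit [TopologicalSpace G] [IsTopologicalGroup G] [CompactSpace G] [BorelSpace G] [Fintype A] in
/-- `revConfig` is measurable. [folklore] -/
theorem measurable_revConfig [MeasurableInv G] (e : Fin d → A) (j : Fin d) :
    Measurable (revConfig (G := G) e j) := by
  refine measurable_pi_lambda _ fun l => ?_
  by_cases hl : l.2 = j
  · simp only [revConfig, hl, ↓reduceIte]
    exact (measurable_pi_apply _).inv
  · simp only [revConfig, hl, ↓reduceIte]
    exact measurable_pi_apply _

/-- `revConfig` as a measurable equivalence (inverse: `revConfig` of the reversed presentation).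
[folklore] -/
def revEquiv (e : Fin d → A) (j : Fin d) : Config A d G ≃ᵐ Config A d G where
  toFun := revConfig e j
  invFun := revConfig (revAxis e j) j
  left_inv := revConfig_revConfig e j
  right_inv := revConfig_revConfig' e j
  measurable_toFun := measurable_revConfig e j
  measurable_invFun := measurable_revConfig (revAxis e j) j

/-- **The Wilson measures of the two presentations correspond under `revConfig`**:
`∫ F(revConfig e j U) dμ_{e,β}(U) = ∫ F dμ_{e',β}` (every real `F`, every real `β`; a change of
variables along a measurable bijection, no measurability of `F` needed). [folklore] -/
theorem integral_comp_revConfig_gibbs (hρ : Continuous ρ) (e : Fin d → A) (j : Fin d) (β : ℝ)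
    (F : Config A d G → ℝ) :
    ∫ U, F (revConfig e j U) ∂(gibbs ρ e β) = ∫ V, F V ∂(gibbs ρ (revAxis e j) β) := by
  have hT : MeasurePreserving (revEquiv (G := G) e j) (productHaar A d G) (productHaar A d G) :=
    measurePreserving_revConfig e j
  rw [integral_gibbs, integral_gibbs]
  -- the normalisers agree
  have hZ : ∫ V, Real.exp (-β * wilsonAction ρ (revAxis e j) V) ∂(productHaar A d G) =
      ∫ U, Real.exp (-β * wilsonAction ρ e U) ∂(productHaar A d G) := by
    rw [← hT.integral_comp' (fun V => Real.exp (-β * wilsonAction ρ (revAxis e j) V))]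
    exact integral_congr_ae (ae_of_all _ fun U => by
      simp only [revEquiv, MeasurableEquiv.coe_mk, Equiv.coe_fn_mk, wilsonAction_revConfig ρ hρ])
  rw [hZ, ← hT.integral_comp' (fun V => (Real.exp (-β * wilsonAction ρ (revAxis e j) V) /
    ∫ U, Real.exp (-β * wilsonAction ρ e U) ∂(productHaar A d G)) • F V)]
  exact integral_congr_ae (ae_of_all _ fun U => by
    simp only [revEquiv, MeasurableEquiv.coe_mk, Equiv.coe_fn_mk, wilsonAction_revConfig ρ hρ])

/-- The same for complex observables. [folklore] -/
theorem integral_comp_revConfig_gibbs_complex (hρ : Continuous ρ) (e : Fin d → A) (j : Fin d) (β : ℝ)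
    (F : Config A d G → ℂ) :
    ∫ U, F (revConfig e j U) ∂(gibbs ρ e β) = ∫ V, F V ∂(gibbs ρ (revAxis e j) β) := by
  have hT : MeasurePreserving (revEquiv (G := G) e j) (productHaar A d G) (productHaar A d G) :=
    measurePreserving_revConfig e j
  rw [integral_gibbs, integral_gibbs]
  have hZ : ∫ V, Real.exp (-β * wilsonAction ρ (revAxis e j) V) ∂(productHaar A d G) =
      ∫ U, Real.exp (-β * wilsonAction ρ e U) ∂(productHaar A d G) := by
    rw [← hT.integral_comp' (fun V => Real.exp (-β * wilsonAction ρ (revAxis e j) V))]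
    exact integral_congr_ae (ae_of_all _ fun U => by
      simp only [revEquiv, MeasurableEquiv.coe_mk, Equiv.coe_fn_mk, wilsonAction_revConfig ρ hρ])
  rw [hZ, ← hT.integral_comp' (fun V => (Real.exp (-β * wilsonAction ρ (revAxis e j) V) /
    ∫ U, Real.exp (-β * wilsonAction ρ e U) ∂(productHaar A d G)) • F V)]
  exact integral_congr_ae (ae_of_all _ fun U => by
    simp only [revEquiv, MeasurableEquiv.coe_mk, Equiv.coe_fn_mk, wilsonAction_revConfig ρ hρ])

end Measure

end TiltedRP

end Summit.QuantumFields.GaugeBoot
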